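import Summits.KontsevichZagierPeriods.KontsevichZagierPeriods.Theorems.K2SymbolChainsClausenPiVanishesBandRep
import Summits.KontsevichZagierPeriods.KontsevichZagierPeriods.Theorems.K2SymbolChainsClausenPiVanishesAtoms

/-!
# Jensen at `|α| = 1` by doubling, I: the moves

Route item ClausenPiVanishes (stmt-KontsevichZagierPeriods-5202) of route
KontsevichZagierPeriods/K2SymbolChains. With `σ = {t ≠ 0} ⊆ ℝ¹`, `h = 1/(1+t²)`,
`A = (1+t²)/t²` (`= 4/|1 − e(t)|²`), `B = 1 + t²` (`= 4/|1 + e(t)|²`), all `≥ 1` on `σ`, and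
`L(g, F) = [{t ∈ σ, 1 ≤ u ≤ F(t)}, g(t)/u]` (the unfolded `∫ g log F`), this file proves the single
moves of the doubling chain inside `KZ.relations`:
(S1) `L(A·B) ∼ L(A) + L(B)` and (S7) `L(4A) ∼ L(4) + L(A)` (product rule = domain additivity +
dilation, `KZ.of_sub_of_sub_mem_relations_mul`); (S6) `L(h, 4A) ∼ 2 L(h/2, 4A)` (integrand
additivity); (S2) `L(B) ∼ L(A)` (the half-turn `t ↦ −1/t`, rule 2)); (S3) `L(A·B)` splits over the
two sheets `{0 < |t| < 1}`, `{|t| > 1}`; and the algebra of the sheet map `s = 2t/(1 − t²)`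
(`4A(s) = A(t)B(t)`, `h(t) dt = (h/2)(s) ds`, injectivity, images). Sources: M. Kontsevich,
D. Zagier, *Periods* (2001), §1.2 (rules 1)–2)); J. McKee, C. Smyth, *Around the Unit Circle*
(2021), Ch. 1–2 (Jensen's formula). [folklore]
-/

noncomputable section

open MeasureTheory Set Filter MvPolynomial
open Literature.ModelTheory.ExponentialFields (IsSemialgebraic tarski_seidenberg_real_holds
  isSemialgebraic_setOf_eval_lt isSemialgebraic_setOf_eval_le isSemialgebraic_setOf_eval_ne_zero
  isSemialgebraic_setOf_eval_eq_zero isSemialgebraic_univ)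
open Literature.NumberTheory.Transcendental
open Literature.NumberTheory.Transcendental.KZ

namespace Summit.KontsevichZagierPeriods.K2SymbolChains.ClausenPi

/-! ### Pointwise facts on `σ = {t ≠ 0}` -/

/-- `A = (1+t²)/t² ≥ 1` for `t ≠ 0`. [folklore] -/
theorem one_le_A {x : Fin 1 → ℝ} (hx : x 0 ≠ 0) : (1 : ℝ) ≤ (1 + x 0 ^ 2) / x 0 ^ 2 := by
  have h2 : (0 : ℝ) < x 0 ^ 2 := by positivity
  rw [le_div_iff₀ h2]
  linarith

/-- `B = 1 + t² ≥ 1`. [folklore] -/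
theorem one_le_B (x : Fin 1 → ℝ) : (1 : ℝ) ≤ 1 + x 0 ^ 2 := by nlinarith [sq_nonneg (x 0)]

/-! ### (S1) the product rule `log (A·B) = log A + log B`, unfolded -/

/-- **(S1)** `[band σ 1 (A·B), h/u] − [band σ 1 A, h/u] − [band σ 1 B, h/u] ∈ relations`
(`KZ.of_sub_of_sub_mem_relations_mul`, `A, B ≥ 1` on `σ = {t ≠ 0}`). [Kontsevich–Zagier 2001,
§1.1–1.2] [folklore] -/
theorem mul_AB (c a b : KZ.IntegralRep 2)
    (hcd : c.domain = KZlog.band {x : Fin 1 → ℝ | x 0 ≠ 0} (fun _ => 1)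
      (fun x => (1 + x 0 ^ 2) / x 0 ^ 2 * (1 + x 0 ^ 2)))
    (hci : c.integrand = fun z => 1 / (1 + Fin.init z 0 ^ 2) / z (Fin.last 1))
    (had : a.domain = KZlog.band {x : Fin 1 → ℝ | x 0 ≠ 0} (fun _ => 1)
      (fun x => (1 + x 0 ^ 2) / x 0 ^ 2))
    (hai : a.integrand = fun z => 1 / (1 + Fin.init z 0 ^ 2) / z (Fin.last 1))
    (hbd : b.domain = KZlog.band {x : Fin 1 → ℝ | x 0 ≠ 0} (fun _ => 1) (fun x => 1 + x 0 ^ 2))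
    (hbi : b.integrand = fun z => 1 / (1 + Fin.init z 0 ^ 2) / z (Fin.last 1)) :
    KZ.of c - KZ.of a - KZ.of b ∈ KZ.relations :=
  of_sub_of_sub_mem_relations_mul (g := fun x : Fin 1 → ℝ => 1 / (1 + x 0 ^ 2))
    isSemialgebraic_ne_zero (isSemialgebraicFunOn_A isSemialgebraic_ne_zero fun _ hx => hx)
    (isSemialgebraicFunOn_B isSemialgebraic_ne_zero) (fun _ hx => one_le_A hx)
    (fun x _ => one_le_B x) c a b hcd (fun z _ => by rw [hci]) had (fun z _ => by rw [hai]) hbd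
    (fun z _ => by rw [hbi])

/-! ### (S7) the product rule `log (4·A) = log 4 + log A`, unfolded -/

/-- **(S7)** `[band σ 1 (4A), h/u] − [band σ 1 4, h/u] − [band σ 1 A, h/u] ∈ relations`.
[Kontsevich–Zagier 2001, §1.1–1.2] [folklore] -/
theorem mul_four_A (d e a : KZ.IntegralRep 2)
    (hdd : d.domain = KZlog.band {x : Fin 1 → ℝ | x 0 ≠ 0} (fun _ => 1)
      (fun x => 4 * ((1 + x 0 ^ 2) / x 0 ^ 2)))
    (hdi : d.integrand = fun z => 1 / (1 + Fin.init z 0 ^ 2) / z (Fin.last 1))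
    (hed : e.domain = KZlog.band {x : Fin 1 → ℝ | x 0 ≠ 0} (fun _ => 1) (fun _ => 4))
    (hei : e.integrand = fun z => 1 / (1 + Fin.init z 0 ^ 2) / z (Fin.last 1))
    (had : a.domain = KZlog.band {x : Fin 1 → ℝ | x 0 ≠ 0} (fun _ => 1)
      (fun x => (1 + x 0 ^ 2) / x 0 ^ 2))
    (hai : a.integrand = fun z => 1 / (1 + Fin.init z 0 ^ 2) / z (Fin.last 1)) :
    KZ.of d - KZ.of e - KZ.of a ∈ KZ.relations :=
  of_sub_of_sub_mem_relations_mul (g := fun x : Fin 1 → ℝ => 1 / (1 + x 0 ^ 2))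
    (u := fun _ => (4 : ℝ))
    isSemialgebraic_ne_zero (isSemialgebraicFunOn_four isSemialgebraic_ne_zero)
    (isSemialgebraicFunOn_A isSemialgebraic_ne_zero fun _ hx => hx) (fun _ _ => by norm_num)
    (fun _ hx => one_le_A hx) d e a hdd (fun z _ => by rw [hdi]) hed (fun z _ => by rw [hei]) had
    (fun z _ => by rw [hai])

/-! ### (S6) halving the integrand -/

/-- **(S6)** `[band σ 1 (4A), h/u] − 2 · [band σ 1 (4A), (h/2)/u] ∈ relations` (integrand
additivity, rule 1b)). [Kontsevich–Zagier 2001, §1.2, rule 1)] [folklore] -/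
theorem halves (d d₂ : KZ.IntegralRep 2)
    (hdd : d.domain = KZlog.band {x : Fin 1 → ℝ | x 0 ≠ 0} (fun _ => 1)
      (fun x => 4 * ((1 + x 0 ^ 2) / x 0 ^ 2)))
    (hdi : d.integrand = fun z => 1 / (1 + Fin.init z 0 ^ 2) / z (Fin.last 1))
    (hd₂d : d₂.domain = KZlog.band {x : Fin 1 → ℝ | x 0 ≠ 0} (fun _ => 1)
      (fun x => 4 * ((1 + x 0 ^ 2) / x 0 ^ 2)))
    (hd₂i : d₂.integrand = fun z => 1 / (1 + Fin.init z 0 ^ 2) / 2 / z (Fin.last 1)) :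
    KZ.of d - KZ.of d₂ - KZ.of d₂ ∈ KZ.relations := by
  refine integrandAddRel_subset_relations ⟨2, d, d₂, d₂, by rw [hd₂d, hdd], by rw [hd₂d, hdd],
    fun z _ => ?_, rfl⟩
  simp only [hdi, hd₂i, Pi.add_apply]
  ring

/-! ### (S2) the half-turn `t ↦ −1/t`: `log B ∼ log A` -/

/-- **(S2)** `[band σ 1 B, h/u] − [band σ 1 A, h/u] ∈ relations`: the change of variables
`t ↦ −1/t` of the base (the half-turn `φ ↦ φ + π` of the circle), under which `h(t) dt` is
invariant and `B(−1/t) = A(t)`. [Kontsevich–Zagier 2001, §1.2, rule 2)] [folklore] -/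
theorem shift (b a : KZ.IntegralRep 2)
    (hbd : b.domain = KZlog.band {x : Fin 1 → ℝ | x 0 ≠ 0} (fun _ => 1) (fun x => 1 + x 0 ^ 2))
    (hbi : b.integrand = fun z => 1 / (1 + Fin.init z 0 ^ 2) / z (Fin.last 1))
    (had : a.domain = KZlog.band {x : Fin 1 → ℝ | x 0 ≠ 0} (fun _ => 1)
      (fun x => (1 + x 0 ^ 2) / x 0 ^ 2))
    (hai : a.integrand = fun z => 1 / (1 + Fin.init z 0 ^ 2) / z (Fin.last 1)) :
    KZ.of b - KZ.of a ∈ KZ.relations := by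
  refine of_sub_of_mem_relations_covLift_one isSemialgebraic_ne_zero (φ := fun t => -t⁻¹)
    (φ' := fun t => (t ^ 2)⁻¹) ?_
    (fun x hx => by simpa [Pi.neg_def] using (hasDerivAt_inv (hx : x 0 ≠ 0)).neg)
    (fun x hx y hy h => by simpa using h) ?_
    (v := fun x => 1 + x 0 ^ 2) (v' := fun x => (1 + x 0 ^ 2) / x 0 ^ 2)
    (g := fun x => 1 / (1 + x 0 ^ 2)) (g' := fun x => 1 / (1 + x 0 ^ 2))
    (fun x hx => ?_) (fun x hx => ?_) b a hbd hbi had hai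
  · exact ((isSemialgebraicFunOn_aeval_div_aeval isSemialgebraic_ne_zero (-1) (X 0)
      fun x hx => by simpa using hx).congr fun x _ => by simp [neg_div])
  · ext y
    simp only [mem_image, mem_setOf_eq]
    constructor
    · rintro ⟨x, hx, rfl⟩
      simpa using hx
    · intro hy
      refine ⟨fun _ => -(y 0)⁻¹, by simpa using hy, ?_⟩
      funext i
      rw [Fin.fin_one_eq_zero i]
      simp
  · have hx' : (x 0 : ℝ) ≠ 0 := hx
    field_simp
    ring
  · have hx' : (x 0 : ℝ) ≠ 0 := hx
    rw [abs_of_pos (by positivity)]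
    field_simp
    ring


/-! ### (S3) the two sheets `|t| < 1`, `|t| > 1` of the double cover `ψ = 2φ` -/

/-- **(S3)** Splitting `[band σ 1 (A·B), h/u]` over `σ = {0 < |t| < 1} ∪ {|t| > 1} ∪ {t² = 1}`
(domain additivity; the band over the two points `t = ±1` is null).
[Kontsevich–Zagier 2001, §1.2, rule 1)] [folklore] -/
theorem split_sheets (c : KZ.IntegralRep 2)
    (hcd : c.domain = KZlog.band {x : Fin 1 → ℝ | x 0 ≠ 0} (fun _ => 1)
      (fun x => (1 + x 0 ^ 2) / x 0 ^ 2 * (1 + x 0 ^ 2))) :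
    ∃ c₁ c₂ : KZ.IntegralRep 2,
      c₁.domain = KZlog.band {x : Fin 1 → ℝ | x 0 ≠ 0 ∧ x 0 ^ 2 < 1} (fun _ => 1)
        (fun x => (1 + x 0 ^ 2) / x 0 ^ 2 * (1 + x 0 ^ 2)) ∧ c₁.integrand = c.integrand ∧
      c₂.domain = KZlog.band {x : Fin 1 → ℝ | 1 < x 0 ^ 2} (fun _ => 1)
        (fun x => (1 + x 0 ^ 2) / x 0 ^ 2 * (1 + x 0 ^ 2)) ∧ c₂.integrand = c.integrand ∧
      KZ.of c - KZ.of c₁ - KZ.of c₂ ∈ KZ.relations := by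
  have hσ := isSemialgebraic_ne_zero
  have hσ₁ : IsSemialgebraic ℚ {x : Fin 1 → ℝ | x 0 ≠ 0 ∧ x 0 ^ 2 < 1} :=
    hσ.inter isSemialgebraic_sq_lt_one
  have hσ₂ : IsSemialgebraic ℚ {x : Fin 1 → ℝ | 1 < x 0 ^ 2} := isSemialgebraic_one_lt_sq
  set N : Set (Fin 1 → ℝ) := {x : Fin 1 → ℝ | x 0 ≠ 0} \
    ({x | x 0 ≠ 0 ∧ x 0 ^ 2 < 1} ∪ {x | 1 < x 0 ^ 2}) with hN
  have hNs : IsSemialgebraic ℚ N := hσ.diff (hσ₁.union hσ₂)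
  have hN0 : volume N = 0 := by
    refine measure_mono_null (fun x hx => ?_)
      (measure_union_null (volume_setOf_last_eq_zero (n := 0) 1)
        (volume_setOf_last_eq_zero (n := 0) (-1)))
    simp only [hN, Set.mem_sdiff, mem_setOf_eq, mem_union, not_or, not_and, not_lt] at hx
    obtain ⟨hx0, h1, h2⟩ := hx
    have hsq : x 0 ^ 2 = 1 := le_antisymm h2 (h1 hx0)
    rcases sq_eq_one_iff.1 hsq with h | h
    · exact Or.inl h
    · exact Or.inr h
  have hAB : IsSemialgebraicFunOn ℚ {x : Fin 1 → ℝ | x 0 ≠ 0}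
      (fun x => (1 + x 0 ^ 2) / x 0 ^ 2 * (1 + x 0 ^ 2)) :=
    IsSemialgebraicFunOn.mul_holds (isSemialgebraicFunOn_A hσ fun _ hx => hx)
      (isSemialgebraicFunOn_B hσ)
  have hdec : {x : Fin 1 → ℝ | x 0 ≠ 0} =
      {x | x 0 ≠ 0 ∧ x 0 ^ 2 < 1} ∪ ({x | 1 < x 0 ^ 2} ∪ N) := by
    rw [← union_assoc, hN, union_sdiff_cancel]
    rintro x (hx | hx)
    · exact hx.1
    · intro (h0 : x 0 = 0)
      have : (1 : ℝ) < x 0 ^ 2 := hx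
      rw [h0] at this
      norm_num at this
  have hdisj : {x : Fin 1 → ℝ | x 0 ≠ 0 ∧ x 0 ^ 2 < 1} ∩ ({x | 1 < x 0 ^ 2} ∪ N) = ∅ := by
    ext x
    simp only [mem_inter_iff, mem_setOf_eq, mem_union, mem_empty_iff_false, iff_false, not_and]
    rintro ⟨hx0, hx1⟩ (hx | hx)
    · exact absurd (hx1.trans hx) (lt_irrefl _)
    · exact hx.2 (Or.inl ⟨hx0, hx1⟩)
  have hdisj' : {x : Fin 1 → ℝ | 1 < x 0 ^ 2} ∩ N = ∅ := by
    ext x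
    simp only [mem_inter_iff, mem_empty_iff_false, iff_false, not_and]
    exact fun hx hxN => hxN.2 (Or.inr hx)
  have hsub : {x : Fin 1 → ℝ | 1 < x 0 ^ 2} ∪ N ⊆ {x : Fin 1 → ℝ | x 0 ≠ 0} :=
    hdec ▸ subset_union_right
  obtain ⟨c₁, cr, h1d, h1i, hrd, hri, hrel⟩ := exists_split_band c hcd hdec hdisj hσ₁ (hσ₂.union hNs)
    (isSemialgebraicFunOn_one hσ) hAB
  obtain ⟨c₂, cN, h2d, h2i, hNd, -, hrel'⟩ := exists_split_band cr hrd rfl hdisj' hσ₂ hNs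
    (isSemialgebraicFunOn_one (hσ₂.union hNs)) (hAB.mono hsub (hσ₂.union hNs))
  have hJ : KZ.of cN ∈ KZ.relations :=
    of_mem_relations_of_volume_eq_zero _ (measure_mono_null
      (hNd ▸ band_subset_setOf_init_mem) (volume_setOf_init_mem_eq_zero hN0))
  refine ⟨c₁, c₂, h1d, h1i, h2d, h2i.trans hri, ?_⟩
  have : KZ.of c - KZ.of c₁ - KZ.of c₂ =
      (KZ.of c - KZ.of c₁ - KZ.of cr) + (KZ.of cr - KZ.of c₂ - KZ.of cN) + KZ.of cN := by abel
  rw [this]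
  exact KZ.relations.add_mem (KZ.relations.add_mem hrel hrel') hJ

/-! ### (S4), (S5) the sheet maps `s = 2t/(1 − t²)` -/

/-- The derivative of `s(t) = 2t/(1 − t²)` is `2(1 + t²)/(1 − t²)²`. [folklore] -/
theorem hasDerivAt_sheet {t : ℝ} (ht : 1 - t ^ 2 ≠ 0) :
    HasDerivAt (fun t : ℝ => 2 * t / (1 - t ^ 2)) (2 * (1 + t ^ 2) / (1 - t ^ 2) ^ 2) t := by
  have h1 : HasDerivAt (fun t : ℝ => 2 * t) 2 t := by
    simpa using (hasDerivAt_id t).const_mul (2 : ℝ)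
  have h2 : HasDerivAt (fun t : ℝ => 1 - t ^ 2) (-(2 * t)) t := by
    simpa using (hasDerivAt_pow 2 t).const_sub 1
  refine (h1.div h2 ht).congr_deriv ?_
  congr 1
  ring

/-- `4 · A(s(t)) = A(t) · B(t)` for `s = 2t/(1 − t²)` (the doubling identity
`|1 − e^{2iφ}|² = |1 − e^{iφ}|² |1 + e^{iφ}|²`). [folklore] -/
theorem four_mul_A_sheet {t : ℝ} (ht : t ≠ 0) (ht1 : 1 - t ^ 2 ≠ 0) :
    (1 + t ^ 2) / t ^ 2 * (1 + t ^ 2) =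
      4 * ((1 + (2 * t / (1 - t ^ 2)) ^ 2) / (2 * t / (1 - t ^ 2)) ^ 2) := by
  field_simp
  ring

/-- `h(t) = (h/2)(s(t)) · s'(t)` for `s = 2t/(1 − t²)` (`dψ = 2 dφ`). [folklore] -/
theorem h_sheet {t : ℝ} (ht1 : 1 - t ^ 2 ≠ 0) :
    1 / (1 + t ^ 2) = 1 / (1 + (2 * t / (1 - t ^ 2)) ^ 2) / 2 *
      |2 * (1 + t ^ 2) / (1 - t ^ 2) ^ 2| := by
  rw [abs_of_pos (by positivity)]
  field_simp
  ring

/-- The sheet map is injective on each sheet: `s(x) = s(y)` forces `x = y` or `xy = −1`.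
[folklore] -/
theorem sheet_inj {x y : ℝ} (hx : 1 - x ^ 2 ≠ 0) (hy : 1 - y ^ 2 ≠ 0) (hxy : 1 + x * y ≠ 0)
    (h : 2 * x / (1 - x ^ 2) = 2 * y / (1 - y ^ 2)) : x = y := by
  rw [div_eq_div_iff hx hy] at h
  have h' : (x - y) * (1 + x * y) = 0 := by linear_combination h / 2
  rcases mul_eq_zero.1 h' with h'' | h''
  · linarith
  · exact absurd h'' hxy

/-- The inner sheet `{0 < |t| < 1}` is mapped by `s` onto `{s ≠ 0}` (preimage of `s` is
`t = s/(1 + √(1 + s²))`). [folklore] -/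
theorem image_sheet_inner :
    (fun x : Fin 1 → ℝ => fun _ : Fin 1 => 2 * x 0 / (1 - x 0 ^ 2)) ''
      {x : Fin 1 → ℝ | x 0 ≠ 0 ∧ x 0 ^ 2 < 1} = {x : Fin 1 → ℝ | x 0 ≠ 0} := by
  ext y
  simp only [mem_image, mem_setOf_eq]
  constructor
  · rintro ⟨x, ⟨hx0, hx1⟩, rfl⟩
    have : 1 - x 0 ^ 2 ≠ 0 := by linarith
    simp only [ne_eq, div_eq_zero_iff, mul_eq_zero, OfNat.ofNat_ne_zero, false_or, this, or_false]
    exact hx0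
  · intro hy
    set r := Real.sqrt (1 + y 0 ^ 2) with hr
    have hr0 : 0 ≤ r := Real.sqrt_nonneg _
    have hr2 : r ^ 2 = 1 + y 0 ^ 2 := Real.sq_sqrt (by positivity)
    have h1r : (0 : ℝ) < 1 + r := by positivity
    refine ⟨fun _ => y 0 / (1 + r), ⟨?_, ?_⟩, ?_⟩
    · exact div_ne_zero hy h1r.ne'
    · rw [div_pow, div_lt_one (by positivity)]
      nlinarith
    · have hden : 1 - (y 0 / (1 + r)) ^ 2 = 2 / (1 + r) := by
        field_simp
        linear_combination hr2
      funext i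
      rw [Fin.fin_one_eq_zero i, hden]
      field_simp

/-- The outer sheet `{|t| > 1}` is mapped by `s` onto `{s ≠ 0}` (preimage of `s` is
`t = −(1 + √(1 + s²))/s`). [folklore] -/
theorem image_sheet_outer :
    (fun x : Fin 1 → ℝ => fun _ : Fin 1 => 2 * x 0 / (1 - x 0 ^ 2)) ''
      {x : Fin 1 → ℝ | 1 < x 0 ^ 2} = {x : Fin 1 → ℝ | x 0 ≠ 0} := by
  ext y
  simp only [mem_image, mem_setOf_eq]
  constructor
  · rintro ⟨x, hx1, rfl⟩
    have : 1 - x 0 ^ 2 ≠ 0 := by linarith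
    have hx0 : x 0 ≠ 0 := by
      intro h
      rw [h] at hx1
      norm_num at hx1
    simp only [ne_eq, div_eq_zero_iff, mul_eq_zero, OfNat.ofNat_ne_zero, false_or, this, or_false]
    exact hx0
  · intro hy
    set r := Real.sqrt (1 + y 0 ^ 2) with hr
    have hr0 : 0 ≤ r := Real.sqrt_nonneg _
    have hr2 : r ^ 2 = 1 + y 0 ^ 2 := Real.sq_sqrt (by positivity)
    have h1r : (0 : ℝ) < 1 + r := by positivity
    have hy2 : (0 : ℝ) < y 0 ^ 2 := by positivity
    refine ⟨fun _ => -(1 + r) / y 0, ?_, ?_⟩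
    · show (1 : ℝ) < (-(1 + r) / y 0) ^ 2
      rw [div_pow, one_lt_div hy2]
      nlinarith
    · have hden : 1 - (-(1 + r) / y 0) ^ 2 = -2 * (1 + r) / y 0 ^ 2 := by
        field_simp
        linear_combination -hr2
      funext i
      rw [Fin.fin_one_eq_zero i, hden]
      field_simp

/-! ### The doubling relation `log 4 ∼ log A` -/

end Summit.KontsevichZagierPeriods.K2SymbolChains.ClausenPi
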